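import Mathlib.Analysis.Calculus.ImplicitContDiff
import Mathlib.Analysis.Calculus.FDeriv.Analytic
import Mathlib.Analysis.Calculus.FDeriv.Prod
import HarnessLib

/-!
# The analytic implicit-function chart: nearby derivatives, tangent space, factorisation

Family `periods` (periods.S27), topic `Literature/Analysis/Calculus`: calculus used in Wilkie's
desingularisation theorem (den Besten, *Wilkie's Theorem and the Uniform Real Schanuel
Conjecture*, MSc thesis (2016), Thm. 3.2.2, Lemma 3.2.5, the setting of Thm. 3.2.7), on top of
Mathlib's `ContDiffAt.implicitFunction` (`Mathlib.Analysis.Calculus.ImplicitContDiff`).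

For `f : E₁ × E₂ → F` analytic (`ContDiffAt ℝ ω`) at `u` with `∂₂f(u)` invertible, Mathlib
provides the implicit function `ψ` with `f (x, ψ x) = f u` near `u.1`, the description of the level
set near `u` as the graph of `ψ`, the derivative of `ψ` at `u.1`, and `ψ ∈ C^ω` at `u.1`.  We add:

* `hasFDerivAt_of_implicit`: **the derivative formula at nearby points**
  `Dψ(x) = −∂₂f(x, ψ x)⁻¹ ∂₁f(x, ψ x)` wherever `∂₂f(x, ψ x)` is invertible (differentiate
  `f (x, ψ x) = const`);
* `range_chartDeriv_eq_ker`: **the tangent space**: the range of `w ↦ (w, −∂₂f⁻¹ ∂₁f w)` is the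
  kernel of `Df` (den Besten Thm. 3.2.2 (iii) / the set-up of Lemma 3.2.5);
* `comp_chartDeriv_eq_zero_iff`, `fderiv_comp_chart_eq_zero_iff`: **factorisation** (Lemma 3.2.5
  in functional form): a functional kills the tangent space iff it factors through `Df`.

All statements are proved; no named facts.

## References

* M. den Besten, *Wilkie's Theorem and the Uniform Real Schanuel Conjecture*, MSc thesis, Utrecht
  (2016), Thm. 3.2.2, Lemma 3.2.5.
-/

noncomputable section

open scoped Topology ContDiff
open Set Filter

namespace Literature.Analysis.Calculus

variable {E₁ : Type*} [NormedAddCommGroup E₁] [NormedSpace ℝ E₁]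
  {E₂ : Type*} [NormedAddCommGroup E₂] [NormedSpace ℝ E₂]
  {F : Type*} [NormedAddCommGroup F] [NormedSpace ℝ F]
  {G : Type*} [NormedAddCommGroup G] [NormedSpace ℝ G]

/-! ### Partial derivatives on a product and the chart derivative -/

/-- `∂₁` of a map on a product: `Df(p) ∘ inl`. [folklore] -/
abbrev fderiv₁ (f : E₁ × E₂ → F) (p : E₁ × E₂) : E₁ →L[ℝ] F :=
  fderiv ℝ f p ∘L ContinuousLinearMap.inl ℝ E₁ E₂
/-- `∂₂` of a map on a product: `Df(p) ∘ inr`. [folklore] -/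
abbrev fderiv₂ (f : E₁ × E₂ → F) (p : E₁ × E₂) : E₂ →L[ℝ] F :=
  fderiv ℝ f p ∘L ContinuousLinearMap.inr ℝ E₁ E₂

/-- The derivative of the chart `w ↦ (w, ψ w)` when `Dψ = D`: `w ↦ (w, D w)`. [folklore] -/
abbrev chartDeriv (D : E₁ →L[ℝ] E₂) : E₁ →L[ℝ] E₁ × E₂ := (ContinuousLinearMap.id ℝ E₁).prod D

/-- `chartDeriv D w = (w, D w)`. [folklore] -/
theorem chartDeriv_apply (D : E₁ →L[ℝ] E₂) (w : E₁) : chartDeriv D w = (w, D w) := rfl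

/-- The implicit derivative `−A₂⁻¹ A₁` of a linear map `A` on a product with `A₂ = A ∘ inr`
invertible. [folklore] -/
def implicitDeriv (A : E₁ × E₂ →L[ℝ] F) : E₁ →L[ℝ] E₂ :=
  -((A ∘L ContinuousLinearMap.inr ℝ E₁ E₂).inverse ∘L (A ∘L ContinuousLinearMap.inl ℝ E₁ E₂))

/-- `implicitDeriv A w = −A₂⁻¹ (A₁ w)`. [folklore] -/
theorem implicitDeriv_apply (A : E₁ × E₂ →L[ℝ] F) (w : E₁) :
    implicitDeriv A w = -((A ∘L ContinuousLinearMap.inr ℝ E₁ E₂).inverse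
      ((A ∘L ContinuousLinearMap.inl ℝ E₁ E₂) w)) := rfl

/-- Splitting `A (w, y) = A₁ w + A₂ y`. [folklore] -/
theorem apply_pair_eq (A : E₁ × E₂ →L[ℝ] F) (w : E₁) (y : E₂) :
    A (w, y) = (A ∘L ContinuousLinearMap.inl ℝ E₁ E₂) w + (A ∘L ContinuousLinearMap.inr ℝ E₁ E₂) y := by
  rw [ContinuousLinearMap.comp_apply, ContinuousLinearMap.comp_apply, ← map_add]
  simp

/-- `A` kills the chart directions of its implicit derivative: `A (w, −A₂⁻¹A₁ w) = 0`. [folklore] -/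
theorem apply_chartDeriv_implicitDeriv {A : E₁ × E₂ →L[ℝ] F}
    (hA : (A ∘L ContinuousLinearMap.inr ℝ E₁ E₂).IsInvertible) (w : E₁) :
    A (chartDeriv (implicitDeriv A) w) = 0 := by
  rw [chartDeriv_apply, apply_pair_eq, implicitDeriv_apply, map_neg, hA.self_apply_inverse, add_neg_cancel]

/-- **The tangent space** (den Besten Thm. 3.2.2 (iii)): the range of the chart derivative
`w ↦ (w, −A₂⁻¹A₁ w)` is the kernel of `A`. [cite: denBesten2016, Thm. 3.2.2 (iii)] -/
theorem range_chartDeriv_eq_ker {A : E₁ × E₂ →L[ℝ] F}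
    (hA : (A ∘L ContinuousLinearMap.inr ℝ E₁ E₂).IsInvertible) :
    LinearMap.range (chartDeriv (implicitDeriv A) : E₁ →ₗ[ℝ] E₁ × E₂) =
      LinearMap.ker (A : E₁ × E₂ →ₗ[ℝ] F) := by
  apply le_antisymm
  · rintro _ ⟨w, rfl⟩
    exact apply_chartDeriv_implicitDeriv hA w
  · rintro ⟨w, y⟩ hv
    have hv' : A (w, y) = 0 := hv
    rw [apply_pair_eq] at hv'
    -- `A₁ w + A₂ y = 0` forces `y = −A₂⁻¹ A₁ w`
    have hy : y = implicitDeriv A w := by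
      rw [implicitDeriv_apply, ← map_neg, ← eq_neg_of_add_eq_zero_right hv', hA.inverse_apply_self]
    exact ⟨w, by rw [hy]; rfl⟩

/-- **Factorisation through `A`** (den Besten Lemma 3.2.5, functional form): a continuous linear
`φ'` kills all chart directions `(w, −A₂⁻¹A₁ w)` iff `φ' = Λ ∘ A` for some continuous linear
`Λ`. [cite: denBesten2016, Lemma 3.2.5] -/
theorem comp_chartDeriv_eq_zero_iff {A : E₁ × E₂ →L[ℝ] F}
    (hA : (A ∘L ContinuousLinearMap.inr ℝ E₁ E₂).IsInvertible) (φ' : E₁ × E₂ →L[ℝ] G) :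
    φ' ∘L chartDeriv (implicitDeriv A) = 0 ↔ ∃ Λ : F →L[ℝ] G, φ' = Λ ∘L A := by
  constructor
  · intro h
    refine ⟨(φ' ∘L ContinuousLinearMap.inr ℝ E₁ E₂) ∘L (A ∘L ContinuousLinearMap.inr ℝ E₁ E₂).inverse,
      ContinuousLinearMap.ext fun v => ?_⟩
    obtain ⟨w, y⟩ := v
    have hw : φ' (w, implicitDeriv A w) = 0 := by
      have := congrArg (fun T : E₁ →L[ℝ] G => T w) h
      simpa using this
    -- `φ' (w, y) = φ' (w, D w) + φ'₂ (y - D w)` and `A (w, y) = A₂ (y - D w)`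
    have hdecomp : φ' (w, y) = φ' (w, implicitDeriv A w) +
        (φ' ∘L ContinuousLinearMap.inr ℝ E₁ E₂) (y - implicitDeriv A w) := by
      rw [ContinuousLinearMap.comp_apply, ← map_add]; congr 1; simp
    have hA0 : A (w, implicitDeriv A w) = 0 := apply_chartDeriv_implicitDeriv hA w
    have hAdecomp : A (w, y) = (A ∘L ContinuousLinearMap.inr ℝ E₁ E₂) (y - implicitDeriv A w) := by
      have : A (w, y) = A (w, implicitDeriv A w) + (A ∘L ContinuousLinearMap.inr ℝ E₁ E₂) (y - implicitDeriv A w) := by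
        rw [ContinuousLinearMap.comp_apply, ← map_add]; congr 1; simp
      rw [this, hA0, zero_add]
    rw [ContinuousLinearMap.comp_apply, ContinuousLinearMap.comp_apply, hAdecomp, hA.inverse_apply_self,
      hdecomp, hw, zero_add]
  · rintro ⟨Λ, rfl⟩
    ext w
    rw [ContinuousLinearMap.comp_apply, ContinuousLinearMap.comp_apply, apply_chartDeriv_implicitDeriv hA,
      map_zero, zero_apply]

/-! ### The implicit function of an analytic equation: nearby derivatives -/

section Implicit

variable [CompleteSpace E₁] [CompleteSpace E₂] [CompleteSpace F] {f : E₁ × E₂ → F} {u : E₁ × E₂}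

/-- `ω ≠ 0` in `ℕ∞ω`. [folklore] -/
theorem omega_ne_zero : (ω : ℕ∞ω) ≠ 0 := by simp

/-- The implicit function of an analytic equation is analytic at the base point. [folklore] -/
theorem analyticAt_implicitFunction (cdf : ContDiffAt ℝ ω f u)
    (if₂ : (fderiv ℝ f u ∘L ContinuousLinearMap.inr ℝ E₁ E₂).IsInvertible) :
    AnalyticAt ℝ (cdf.implicitFunction omega_ne_zero if₂) u.1 :=
  (cdf.contDiffAt_implicitFunction omega_ne_zero if₂).analyticAt

/-- The implicit equation holds **locally uniformly**: near `u.1`, every point has a neighbourhood on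
which `f (x, ψ x) = f u`. [folklore] -/
theorem eventually_eventually_apply_implicitFunction (cdf : ContDiffAt ℝ ω f u)
    (if₂ : (fderiv ℝ f u ∘L ContinuousLinearMap.inr ℝ E₁ E₂).IsInvertible) :
    ∀ᶠ x in 𝓝 u.1, ∀ᶠ x' in 𝓝 x, f (x', cdf.implicitFunction omega_ne_zero if₂ x') = f u :=
  (cdf.eventually_apply_implicitFunction omega_ne_zero if₂).eventually_nhds

omit [CompleteSpace E₁] [CompleteSpace E₂] [CompleteSpace F] in
/-- **The derivative of an implicit function at a nearby point**: if `f (x', ψ x') = c` for `x'`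
near `x`, `ψ` is differentiable at `x`, `f` is differentiable at `(x, ψ x)` and `∂₂f(x, ψ x)` is
invertible, then `Dψ(x) = −∂₂f(x, ψ x)⁻¹ ∂₁f(x, ψ x)`. [cite: denBesten2016, Thm. 3.2.2 (iii)] -/
theorem hasFDerivAt_of_implicit {ψ : E₁ → E₂} {x : E₁} {c : F}
    (hx : ∀ᶠ x' in 𝓝 x, f (x', ψ x') = c) (hψ : DifferentiableAt ℝ ψ x)
    (hf : DifferentiableAt ℝ f (x, ψ x)) (hinv : (fderiv₂ f (x, ψ x)).IsInvertible) :
    HasFDerivAt ψ (implicitDeriv (fderiv ℝ f (x, ψ x))) x := by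
  -- differentiate `x' ↦ f (x', ψ x')`, which is locally constant
  have hchart : HasFDerivAt (fun x' => (x', ψ x')) (chartDeriv (fderiv ℝ ψ x)) x :=
    (hasFDerivAt_id x).prodMk hψ.hasFDerivAt
  have hcomp : HasFDerivAt (fun x' => f (x', ψ x')) (fderiv ℝ f (x, ψ x) ∘L chartDeriv (fderiv ℝ ψ x)) x :=
    hf.hasFDerivAt.comp x hchart
  have hconst : HasFDerivAt (fun x' => f (x', ψ x')) (0 : E₁ →L[ℝ] F) x :=
    (hasFDerivAt_const c x).congr_of_eventuallyEq (hx.mono fun x' h => h)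
  have hzero : fderiv ℝ f (x, ψ x) ∘L chartDeriv (fderiv ℝ ψ x) = 0 := hcomp.unique hconst
  -- solve `∂₁f w + ∂₂f (Dψ w) = 0` for `Dψ w`
  have hD : fderiv ℝ ψ x = implicitDeriv (fderiv ℝ f (x, ψ x)) := by
    ext w
    have hw : fderiv ℝ f (x, ψ x) (w, fderiv ℝ ψ x w) = 0 := by
      have := congrArg (fun T : E₁ →L[ℝ] F => T w) hzero
      simpa using this
    rw [apply_pair_eq] at hw
    rw [implicitDeriv_apply, ← map_neg, ← eq_neg_of_add_eq_zero_right hw, hinv.inverse_apply_self]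
  rw [← hD]
  exact hψ.hasFDerivAt

omit [CompleteSpace E₁] [CompleteSpace E₂] [CompleteSpace F] in
/-- **Lemma 3.2.5 for maps through the chart**: for `φ` differentiable at `p = (x, ψ x)` and the
chart `χ x' = (x', ψ x')` with `Dψ(x) = −∂₂f⁻¹∂₁f` (`hasFDerivAt_of_implicit`),
`D(φ ∘ χ)(x) = 0` iff `Dφ(p) = Λ ∘ Df(p)` for some `Λ`. [cite: denBesten2016, Lemma 3.2.5] -/
theorem fderiv_comp_chart_eq_zero_iff {φ : E₁ × E₂ → G} {ψ : E₁ → E₂} {x : E₁}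
    (hφ : DifferentiableAt ℝ φ (x, ψ x))
    (hψ : HasFDerivAt ψ (implicitDeriv (fderiv ℝ f (x, ψ x))) x)
    (hinv : (fderiv₂ f (x, ψ x)).IsInvertible) :
    fderiv ℝ (fun x' => φ (x', ψ x')) x = 0 ↔
      ∃ Λ : F →L[ℝ] G, fderiv ℝ φ (x, ψ x) = Λ ∘L fderiv ℝ f (x, ψ x) := by
  have hchart : HasFDerivAt (fun x' => (x', ψ x')) (chartDeriv (implicitDeriv (fderiv ℝ f (x, ψ x)))) x :=
    (hasFDerivAt_id x).prodMk hψ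
  have hcomp : HasFDerivAt (fun x' => φ (x', ψ x'))
      (fderiv ℝ φ (x, ψ x) ∘L chartDeriv (implicitDeriv (fderiv ℝ f (x, ψ x)))) x :=
    hφ.hasFDerivAt.comp x hchart
  rw [hcomp.fderiv]
  exact comp_chartDeriv_eq_zero_iff hinv _

end Implicit

end Literature.Analysis.Calculus

end
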